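import Summits.Ventures.HodgeRepro2.LiuOscillator
import Summits.Ventures.HodgeRepro2.LiuFace

/-!
# T6B3Hyp — Tier 6 (README §10), sub-goal B3: the DISPLAYED published inputs of B3

Statement lane (TARGET-T6.md v0.1 §4 row L1, §7(c)): `def … : Prop` only, one display per printed
statement, docstring = the printed statement verbatim with its page/line locator, consumed by name in
`B3_main` (file `T6B3Main.lean`) and, through it, in the final theorem.

CARRIERS (all accepted kernel of seat p2, imported by name, nothing re-typed — route/LEAN-ANNEX-p2.md rows
11–13): `Liu.AutomorphicCharacter K` (continuous characters of the idèles of `K` trivial on `Kˣ`),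
`Liu.IdeleConjugation K` (the involution `c` of `𝔸_E`), `Liu.QuadraticCharacter K c` (`μ_{E/F}`),
`Liu.IsConjugateSymplectic` (Def. 4.1), `Liu.IsWeightOne K Φ μ` (Rem. 4.2 / Def. 4.3: `μ_w(z) = z̄/|z|`
for the embedding of `w` in `Φ`), `Liu.OscillatorTriple K c χEF` (Def. 4.11, the class `ε` represented
by a global `e ∈ E^{×−}`), `Liu.IsMuAdmissibleRep` (Def. 4.12 for the representative `e`),
`Liu.OscillatorTriple.IsAdmissible t` (= «μ is of weight one and ε is μ-admissible»), and the DATUM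
`S : Liu.AlbaneseH1Shape K c χEF` = the objects of Liu §4.2 that the kernel cannot construct (a
Shimura variety and its Albanese tower), recorded as data: `S.rank` = n; `S.Rep` = isomorphism classes
of irreducible admissible representations of `G(𝔸_F^∞)`; `S.osc t` = `ω(μ, ε, χ)` (Def. 4.11, p. 46
ll. 50–61); `S.mult τ' π` = the multiplicity of `π` in `H^1_{B,τ'}(A_∞, ℂ)` (p. 46 ll. 25–31);
`S.Level` = the open compact subgroups `K ⊆ G(𝔸_F^∞)` ordered by inclusion, `S.IsSmall L` =
«sufficiently small» (downward closed); `S.dimInv π L` = `dim_ℂ π^K`; `S.galOrbit` = the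
`Gal(ℂ/ℚ)`-orbit relation on characters; `S.IsogClass` = isogeny classes of abelian varieties over `E`
(a commutative monoid under product); `S.albanese L` = the class of `A_K := Alb_{X_K}` (p. 46 ll. 10–22);
`S.cmVariety μ` = the class of `A_μ` for an object `D_μ ∈ A(μ)` (Def. 4.5, independent of the object
by Prop. 4.6(1)); `S.homDim L μ` = `dim Hom_E(A_K, A_μ)_ℚ`; `S.omegaInvDim L μ` = `dim Ω(μ)^K`
(Def. 4.16; both dimensions over the same field). The standing setting of Liu §4 / §4.2 in force in every
display: «Let F be a totally real number field of degree d ⩾ 1, and E/F a totally imaginary quadratic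
extension.» (p. 40 ll. 35–36) — here `E := K` (a CM number field, Mathlib `NumberField.IsCMField K`) and
`F := K⁺`; «Let n ⩾ 2 be an integer. Let V be a totally definite incoherent hermitian space over A_E of
rank n (Definition C.3).» … «Let G := U(V) be the unitary group of V» … «Let {Sh(V)_K}_K be the
projective system of Shimura varieties for V indexed by sufficiently small open compact subgroups K of
G(A_F^∞) (Definition C.6).» … «X_K := \overline{Sh(V)}_K» (p. 45 ll. 46–63); «We denote by A_K the
Albanese variety Alb_{X_K} of X_K (Definition 2.3)» … «A_∞ := lim_K A_K» … «H^1_{B,τ'}(A_∞, C) :=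
lim_K H^1_{B,τ'}(A_K, C), which is an admissible representation of G(A_F^∞).» (p. 46 ll. 10–31).
The identification of this datum with the surface of the transfer (B1/B2/B5) and its existence are NOT
claimed here (README §10.1: the host dictionary / the owners of B1, B2, B5).

Print of record: Yifeng Liu, «Fourier–Jacobi cycles and arithmetic relative trace formula», Cambridge
J. Math. 9 (2021) 1–147 (lit store paper:liu2021-fourier-jacobi-cycles-arithmetic-relative-trace-formula,
journal page layer pNNNN = print page N; LAYER CAVEAT: the layer drops «≠», tildes and the subscripts of
displays — «Mμ» prints Liu's `\tilde M_μ`, displays are transcribed in reading order with ‹…›);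
M. Dimitrov, D. Ramakrishnan, «Arithmetic quotients of the complex ball and a conjecture of Lang»,
Doc. Math. 20 (2015) 1185–1205 (journal print, HOME/route/lit-1-DimitrovRamakrishnan2015-DocMath20-print-
textlayer.txt, pNNNN = print p. N+1184). §8(d): uses an L-value-free non-vanishing device: NO.
-/

namespace Summit.Ventures.HodgeRepro2.T6

open Summit.Ventures.HodgeRepro2 ShimuraData

universe u

variable (K : Type u) [Field K] [NumberField K] [NumberField.IsCMField K]

/-- [cite: DimitrovRamakrishnan2015, Doc. Math. 20 (2015) 1185–1205, Lemma 3.5, print p. 1198, layer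
p0014 ll. 28–32 (display ll. 30–32 in reading order)] «Lemma 3.5. For any CM extension M/F and any CM
type Φ on M, there exist Hecke characters λ of M whose restriction to F equals ω, such that λ_∞(z) =
∏_{v∈Φ} z̄_v/|z_v| for all z ∈ M_∞^×.» — with ω := «the quadratic character of M/F, viewed as a Hecke
character of F» (print p. 1191, layer p0007 ll. 34–35) and «Recall that a CM type Φ on M is the choice,
for each Archimedean place v of F, of an isomorphism M ⊗_{F,v} R ≃ C.» (print p. 1195, layer p0011
ll. 6–7). [display: (M, F, ω) := (K, K⁺, χEF) with χEF : Liu.QuadraticCharacter K c the quadratic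
character of K/K⁺ (p2 Liu.lean, characterised as printed: order 2, non-trivial, trivial on K⁺ˣ and on
norms); «Hecke character λ of M» := Liu.AutomorphicCharacter K; «restriction to F equals ω» :=
Liu.IsConjugateSymplectic K c χEF μ (Liu Def. 4.1, p. 41 ll. 14–17: μ|_{A_F^×} = μ_{E/F}); «CM type Φ on
M» := IsCMType K Φ (a set of embeddings K → ℂ containing exactly one of each conjugate pair = the choice
of M ⊗_{F,v} ℝ ≃ ℂ at every v); «λ_∞(z) = ∏_{v∈Φ} z̄_v/|z_v|» := Liu.IsWeightOne K Φ μ (p2 Liu.lean: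
at the infinite place w the component of μ is z̄/‖z‖ if the embedding of w lies in Φ and z/‖z‖
otherwise — the same formula read in the conjugate coordinate). The display is p2's accepted
Liu.WeightOneCharacterExists K c χEF (LiuFace.lean row L6, «recorded, not proved»), consumed by name.
Specialisation: none (every CM type of the CM field K). FAITHFUL modulo the carrier dictionary above.]
[quote-audit: pending — T6-LIT-REQ posted on STATUS.md by t6-p6] -/
def Hyp.DimitrovRamakrishnan2015_Lemma3_5 (c : Liu.IdeleConjugation K)
    (χEF : Liu.QuadraticCharacter K c) : Prop :=
  Liu.WeightOneCharacterExists K c χEF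

variable {K}

/-- [cite: Liu2021, Cambridge J. Math. 9 (2021) 1–147, Proposition 4.13, print p. 47 ll. 10–22 (the
display ll. 12–18 in reading order); its standing setting §4.2 p. 45 ll. 46–63, p. 46 ll. 10–31] «Proposition
4.13. Suppose that n ⩾ 3. Then for every embedding τ': E → C, there is an isomorphism ‹H^1_{B,τ'}(A_∞,
C) ≃ ⊕_{(μ,ε,χ)} ω(μ, ε, χ)› of C[G(A_F^∞)]-modules, where the direct sum is taken over all adèlic
oscillator triples in which μ is of weight one and ε is μ-admissible.» Companion statements the display
reads it with: the last sentence of its printed proof, p. 49 ll. 33–34: «we may apply the above discussions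
to the representation π to conclude that the dimension of H^1_{B,τ'}(A_∞, C)[ω(μ, ε, χ)] is 1.», and
Lemma D.1(3), p. 125 ll. 32–33 (n ⩾ 3: the local triple is determined by the local oscillator
representation). [display: p2's accepted Liu.LiuProp413Shape K S (LiuOscillator.lean), consumed by name:
under 3 ≤ S.rank, (a) for every τ' and every adèlic oscillator triple t with μ of weight one and ε
μ-admissible (Liu.OscillatorTriple.IsAdmissible K t), the multiplicity S.mult τ' (S.osc t) of ω(μ, ε, χ)
in H^1_{B,τ'}(A_∞, C) is exactly 1, and (b) every irreducible constituent π of H^1_{B,τ'}(A_∞, C)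
(0 < S.mult τ' π) is S.osc t for such a triple t. WEAKER than print: the display records the
multiplicities of the irreducible constituents, not the C[G(A_F^∞)]-module isomorphism; (a) is the
printed decomposition read with Lemma D.1(3) / the proof's last sentence (distinct admissible triples
give non-isomorphic ω, each summand occurs once); the admissibility of H^1_{B,τ'}(A_∞, C) and the
irreducibility of ω(μ, ε, χ) (p. 46 ll. 60–61) are not recorded. «μ is of weight one» := Liu.IsWeightOne
K Φ μ for a CM type Φ (Rem. 4.2 / Def. 4.3, p. 41 ll. 22–36); «ε is μ-admissible» := Liu.IsMuAdmissibleRep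
K Φ e for the global representative e ∈ E^{×−} of ε (Def. 4.12, p. 47 ll. 5–8, witness form). n ⩾ 3 is
the antecedent 3 ≤ S.rank. The scope note of TIER4 §B3 G7 / §B0-T row 14a on the printed proof ([BMM16,
Prop. 13.4] for inner forms; Rem. 4.14 p. 49 ll. 35–36 for n = 3) concerns the proof as printed, not the
statement displayed here.] [quote-audit: pending — T6-LIT-REQ posted on STATUS.md by t6-p6] -/
def Hyp.Liu2021_Prop4_13 {c : Liu.IdeleConjugation K} {χEF : Liu.QuadraticCharacter K c}
    (S : Liu.AlbaneseH1Shape K c χEF) : Prop :=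
  Liu.LiuProp413Shape K S

/-- [cite: Liu2021, Cambridge J. Math. 9 (2021) 1–147, Theorem 4.18 (the isomorphism), print p. 52
ll. 37–47 (display ll. 39–44 in reading order); standing μ of Definition 4.16, p. 52 ll. 6–9; Ω(μ)
p. 52 ll. 23–33] «Definition 4.16. Let μ: E^×\A_E^× → C^× be a conjugate symplectic character of weight
one. For every object D_μ = (A_μ, i_μ, λ_μ, r_μ) ∈ A(μ) (Definition 4.5), the Q-vector space
Hom_E(A_∞, A_μ)_Q is an M̃_μ[G(A_F^∞)]-module, where M̃_μ acts via i_μ and G(A_F^∞) acts M̃_μ-linearly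
via its action on A_∞. Put ‹Ω(μ) := lim_{D_μ ∈ A(μ)} Hom_E(A_∞, A_μ)_Q› in the category of
M̃_μ[G(A_F^∞)]-modules.» «Theorem 4.18. There is an isomorphism ‹Ω(μ) ⊗_{M̃_μ} C ≃ ⊕_ε ⊕_χ ω(μ, ε, χ)›
of C[G(A_F^∞)]-modules, where the direct sum is taken over all ε, χ such that ε is μ-admissible.»
[display: for every adèlic oscillator triple t = (μ, ε, χ) with μ of weight one and ε μ-admissible
(Liu.OscillatorTriple.IsAdmissible K t) and every sufficiently small level L, dim_C ω(μ, ε, χ)^K ≤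
dim Ω(μ)^K (S.dimInv (S.osc t) L ≤ S.omegaInvDim L t.μ). WEAKER than print: the printed isomorphism, read
on K-invariants (exact on smooth representations of the open compact K), gives dim Ω(μ)^K ⊗ C =
Σ_{ε,χ} dim ω(μ, ε, χ)^K; the display keeps only the term-wise inequality «each summand's K-invariants
embed», which is what B3/B7(b) consume (Hom_E(A_K, A_μ)_Q ≠ 0 from ω(μ, ε, χ)^K ≠ 0 through Theorem
4.18(1)). The conjugate-symplectic weight-one hypothesis on μ is carried by t (Liu.OscillatorTriple.μ_symplectic
and IsAdmissible).] [quote-audit: pending — T6-LIT-REQ posted on STATUS.md by t6-p6] -/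
def Hyp.Liu2021_Thm4_18_iso {c : Liu.IdeleConjugation K} {χEF : Liu.QuadraticCharacter K c}
    (S : Liu.AlbaneseH1Shape K c χEF) : Prop :=
  ∀ t : Liu.OscillatorTriple K c χEF, Liu.OscillatorTriple.IsAdmissible K t →
    ∀ L : S.Level, S.IsSmall L → S.dimInv (S.osc t) L ≤ S.omegaInvDim L t.μ

/-- [cite: Liu2021, Cambridge J. Math. 9 (2021) 1–147, Theorem 4.18(1), print p. 52 ll. 48–51; standing μ
of Definition 4.16, p. 52 ll. 6–8] «Theorem 4.18. … Moreover, (1) For every object D_μ = (A_μ, i_μ, λ_μ,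
r_μ) ∈ A(μ), we have a canonical isomorphism Ω(μ)^K ≃ Hom_E(A_K, A_μ)_Q for every sufficiently small open
compact subgroup K ⊆ G(A_F^∞).» — μ «a conjugate symplectic character of weight one» (Definition 4.16,
p. 52 ll. 6–8). [display: p2's accepted Liu.LiuThm418Shape K S (LiuOscillator.lean), consumed by name: for
every μ conjugate symplectic of weight one (Liu.IsWeightOneConjugateSymplectic K c χEF μ) and every
sufficiently small level L, S.omegaInvDim L μ = S.homDim L μ (the two dimensions over the same field,
M̃_μ — equivalently Q up to the common factor [M̃_μ : Q]). WEAKER than print: only the equality of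
dimensions is recorded, not the canonical isomorphism; «for every object D_μ ∈ A(μ)» is absorbed in the
datum (S.homDim is independent of the object: Rem. 4.17, p. 52 ll. 34–36).] [quote-audit: pending —
T6-LIT-REQ posted on STATUS.md by t6-p6] -/
def Hyp.Liu2021_Thm4_18_1 {c : Liu.IdeleConjugation K} {χEF : Liu.QuadraticCharacter K c}
    (S : Liu.AlbaneseH1Shape K c χEF) : Prop :=
  Liu.LiuThm418Shape K S

/-- [cite: Liu2021, Cambridge J. Math. 9 (2021) 1–147, Corollary 4.20, print p. 54 l. 49 – p. 55 l. 19
(the displays p. 54 ll. 53–71 and p. 55 ll. 10–15 in reading order); Definition 4.19 p. 54 ll. 43–48]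
«Corollary 4.20. Take an arbitrary object D_μ = (A_μ, i_μ, λ_μ, r_μ) ∈ A(μ). For every sufficiently small
open compact subgroup K of G(A_F^∞), there is an isogeny decomposition ‹A_K ∼ ∏_μ A_μ^{d(μ,K)}, resp.
A_K^{end} ∼ ∏_μ A_μ^{d(μ,K)}› of abelian varieties over E when n ⩾ 3 (resp. n = 2), where the product is
taken over representatives of Gal(C/Q)-orbits of all conjugate symplectic automorphic characters of A_E^×
of weight one. Here, A_K^{end} is the endoscopic part of A_K when n = 2, defined in (D.3), and ‹d(μ, K) :=
Σ_ε Σ_χ dim_C ω(μ, ε, χ)^K›, where the sum is taken over all ε, χ such that ε is μ-admissible. It is clear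
that the integer d(μ, K) depends only on the Gal(C/Q)-orbit of μ.» [display: p2's accepted
Liu.LiuCor420Shape K S (LiuOscillator.lean), consumed by name, the case n ⩾ 3 (antecedent 3 ≤ S.rank): for
every sufficiently small L there are a finite set reps of conjugate symplectic weight-one characters,
one per Gal(C/Q)-orbit (S.galOrbit), and for every μ a finite set T μ of admissible triples with first
component μ exhausting the ω(μ, ε, χ) with non-zero K-invariants, such that every weight-one conjugate
symplectic μ with d(μ, K) > 0 is orbit-equivalent to a member of reps, and S.albanese L = ∏_{μ ∈ reps}
S.cmVariety μ ^ d(μ, K) in the monoid of isogeny classes, with d(μ, K) := Liu.liuMultiplicity K S (T μ) L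
= Σ_{π ∈ S.osc '' T μ} S.dimInv π L (the printed sum over the distinct ω(μ, ε, χ), each counted once).
WEAKER than print: the n = 2 endoscopic case and «depends only on the Gal(C/Q)-orbit» are not recorded;
the isogeny decomposition is recorded as an equation in the commutative monoid S.IsogClass.]
[quote-audit: pending — T6-LIT-REQ posted on STATUS.md by t6-p6] -/
def Hyp.Liu2021_Cor4_20 {c : Liu.IdeleConjugation K} {χEF : Liu.QuadraticCharacter K c}
    (S : Liu.AlbaneseH1Shape K c χEF) : Prop :=
  Liu.LiuCor420Shape K S

#check @Hyp.DimitrovRamakrishnan2015_Lemma3_5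
#check @Hyp.Liu2021_Prop4_13
#check @Hyp.Liu2021_Thm4_18_iso
#check @Hyp.Liu2021_Thm4_18_1
#check @Hyp.Liu2021_Cor4_20

end Summit.Ventures.HodgeRepro2.T6

/-! ## v2 (append-only: the five displays above are byte-identical to v1 = p400158, commit 2174a2266948)

### Quote-audit register (t6-lit, STATUS l. 4301; route/T6-LIT-SOURCES.md §3 rows 4–8 — an audit id certifies
the QUOTE and the LOCATOR against the named layer, never the faithfulness of the Lean Prop)
- `Hyp.DimitrovRamakrishnan2015_Lemma3_5` — [quote-audit: QA-t6lit-4] EXACT. ERRATUM to the v1 docstring's locator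
  of the ω-sentence: «the quadratic character of M/F, viewed as a Hecke character of F» is print p. 1190, layer
  route/lit-1-DimitrovRamakrishnan2015-DocMath20-print-textlayer.txt p0006 ll. 34–35 (the v1 docstring says
  «print p. 1191, layer p0007 ll. 34–35» — wrong page; the quotation itself is exact). Lemma 3.5 = print p. 1198
  = that layer's p0014 ll. 28–32; the CM-type sentence = print p. 1195 = p0011 ll. 6–7 (both confirmed).
- `Hyp.Liu2021_Prop4_13` — [quote-audit: QA-t6lit-5] EXACT (page layer p0047 ll. 10–22, ⊕ restored from the arXiv
  TeX layer; proof tail p0049 ll. 33–34; Lemma D.1(3) p0125 ll. 32–33).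
- `Hyp.Liu2021_Thm4_18_iso` — [quote-audit: QA-t6lit-6] EXACT except one glyph: the v1 docstring prints «M̃_μ»
  (tilde, ×4: in the Def. 4.16 quotation and in the Theorem 4.18 display) where both held layers print plain
  «M_μ» (journal page layer p0052; arXiv TeX layer p0022 l. 51 «M_\mu»). The tilde follows TIER4 §B3 B3(a)'s LAYER
  CAVEAT (the journal print's M̃_μ, the field generated by the values of μ^alg, is printed without its tilde by the
  held page layer; the arXiv version names the same field M_μ, TIER4 B3 DICTIONARY D10); for byte-exactness against
  the held layers read «M_μ» — the mathematics and the display are unchanged.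
- `Hyp.Liu2021_Thm4_18_1` — [quote-audit: QA-t6lit-7] EXACT (p0052 ll. 48–51).
- `Hyp.Liu2021_Cor4_20` — [quote-audit: QA-t6lit-8] EXACT (p0054 l. 49 – p0055 l. 19; ∼ ∏ Σ dim_C restored from the
  TeX layer p0023 ll. 45–56).
Layer files of record (TARGET-T6 §7(c) «layer <file>»): Liu 2021 = lit store
paper:liu2021-fourier-jacobi-cycles-arithmetic-relative-trace-formula, per-page files pNNNN.txt (journal page
layer, pNNNN = print page N) and paper:arxiv-2102.11518 (TeX layer, glyph restoration only); DR15 = HOME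
route/lit-1-DimitrovRamakrishnan2015-DocMath20-print-textlayer.txt (journal print, pNNNN = print p. N + 1184).

### Consumers on the tree
`B3_triples` / `B3_main` (T6B3Main.lean, p400263, commit db262cbc2408) consume the five displays by name;
`displays_jointly_satisfiable` (T6B3Toy.lean, p400265, commit cb7a3b80f8f9) exhibits a kernel datum on which the
four datum displays and the B5 interface Prop `Liu.OscillatorAdmissibleShape` hold at once (README §10.5(ii)(d)).
Rulings of record: R5 (displays as predicates of the accepted datum `S : Liu.AlbaneseH1Shape K c χEF`) CONFIRMED
by t6-lead, STATUS l. 4259. -/
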